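import Literature.Probability.RandomPlanarGeometry.CardyFunctionIncBeta
import HarnessLib

/-!
# Cardy's function is comparable to `η^{1/3}` near `0`
# (crux `SubseqCardy`, stmt-CriticalPhenomena-5768, line `registered`, lead c6: kernel facts V, part 2)

Route `CardyAnchoredRigidity`, sub-problem `CardyFormulaZ2`. Pure real analysis, no percolation.

**What.** `cardyFunction_cuberoot_sandwich`: there are constants `c > 0` and `C` with

  `c η^{1/3} ≤ F(η) ≤ C η^{1/3}`  for all `η ∈ (0, 1/2]`,

where `F = Literature.Probability.RandomPlanarGeometry.cardyFunction` is Cardy's crossing function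
`F(η) = (3 Γ(2/3) / Γ(1/3)²) η^{1/3} ₂F₁(1/3, 2/3; 4/3; η)` (Cardy 1992, eq. (11)); i.e. the boundary
power-law exponent of Cardy's kernel is `1/3`. The lead uses it to identify the exponent of the
conjectured kernel in the anchored-rigidity argument.

**How.** Through the incomplete-beta form `F(η) = B(η; 1/3,1/3) / B(1/3,1/3)` on `[0, 1]`
(`Literature.Probability.RandomPlanarGeometry.cardyFunction_eq_incBeta13_div_holds`, Cardy's
eq. (8) integrated), with `B(η; 1/3,1/3) = ∫_0^η (s(1-s))^{-2/3} ds`. For `0 < s ≤ 1/2` one has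
`s/2 ≤ s(1-s) ≤ s`, hence `s^{-2/3} ≤ (s(1-s))^{-2/3} ≤ 2^{2/3} s^{-2/3}`, and
`∫_0^η s^{-2/3} ds = 3 η^{1/3}`. Integrating and dividing by `B := B(1/3,1/3) > 0` gives the claim
with the explicit constants `c = 3/B`, `C = 3 · 2^{2/3}/B`. Helper lemmas live in the inner
namespace `CardyAsymptotics`.

Sources: J. L. Cardy, *Critical percolation in finite geometries*, J. Phys. A 25 (1992) L201,
eqs. (8), (11); R. Beals, R. Wong, *Special functions and orthogonal polynomials* (2016), §10.7
(incomplete beta function).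
-/

noncomputable section

namespace Summit.CriticalPhenomena.CardyFormulaZ2.Cruxes.SubseqCardy.Birth

open Set Filter Topology MeasureTheory intervalIntegral
open Literature.Probability.RandomPlanarGeometry

namespace CardyAsymptotics

/-- Lower pointwise bound for the beta kernel: `s^{-2/3} ≤ (s(1-s))^{-2/3}` for `s ∈ (0, 1)`
(since `s(1-s) ≤ s` and `x ↦ x^{-2/3}` is antitone on `(0, ∞)`). [folklore] -/
theorem cuberoot_rpow_le_betaKernel13 {s : ℝ} (hs : s ∈ Ioo (0 : ℝ) 1) :
    s ^ (-(2 / 3 : ℝ)) ≤ betaKernel13 s := by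
  unfold betaKernel13
  refine Real.rpow_le_rpow_of_nonpos (mul_pos hs.1 (by linarith [hs.2])) ?_ (by norm_num)
  nlinarith [mul_pos hs.1 hs.1]

/-- Upper pointwise bound for the beta kernel: `(s(1-s))^{-2/3} ≤ 2^{2/3} s^{-2/3}` for
`s ∈ (0, 1/2]` (since `s/2 ≤ s(1-s)` there). [folklore] -/
theorem cuberoot_betaKernel13_le {s : ℝ} (hs : s ∈ Ioc (0 : ℝ) (1 / 2)) :
    betaKernel13 s ≤ (2 : ℝ) ^ (2 / 3 : ℝ) * s ^ (-(2 / 3 : ℝ)) := by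
  unfold betaKernel13
  have h1 : s / 2 ≤ s * (1 - s) := by nlinarith [hs.1, hs.2]
  have h2 : (s * (1 - s)) ^ (-(2 / 3 : ℝ)) ≤ (s / 2) ^ (-(2 / 3 : ℝ)) :=
    Real.rpow_le_rpow_of_nonpos (by linarith [hs.1]) h1 (by norm_num)
  have h3 : (s / 2) ^ (-(2 / 3 : ℝ)) = (2 : ℝ) ^ (2 / 3 : ℝ) * s ^ (-(2 / 3 : ℝ)) := by
    rw [Real.div_rpow hs.1.le zero_le_two, Real.rpow_neg zero_le_two, div_inv_eq_mul, mul_comm]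
  exact h2.trans_eq h3

/-- `∫_0^η s^{-2/3} ds = 3 η^{1/3}` (power rule). [folklore] -/
theorem cuberoot_integral_rpow (η : ℝ) :
    ∫ s in (0 : ℝ)..η, s ^ (-(2 / 3 : ℝ)) = 3 * η ^ (1 / 3 : ℝ) := by
  rw [integral_rpow (Or.inl (by norm_num))]
  have e : (-(2 / 3 : ℝ) + 1) = 1 / 3 := by norm_num
  rw [e, Real.zero_rpow (by norm_num)]
  ring

/-- Lower bound for the incomplete beta integral near `0`:
`3 η^{1/3} ≤ B(η; 1/3, 1/3)` for `η ∈ (0, 1/2]`. [folklore] -/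
theorem incBeta13_cuberoot_lower {η : ℝ} (hη : η ∈ Ioc (0 : ℝ) (1 / 2)) :
    3 * η ^ (1 / 3 : ℝ) ≤ incBeta13 η := by
  have hη1 : η ∈ Icc (0 : ℝ) 1 := ⟨hη.1.le, hη.2.trans (by norm_num)⟩
  have h := integral_mono_on_of_le_Ioo (μ := volume) hη.1.le
    (intervalIntegral.intervalIntegrable_rpow' (a := 0) (b := η) (r := -(2 / 3 : ℝ)) (by norm_num))
    (intervalIntegrable_betaKernel13_of_mem ⟨le_rfl, zero_le_one⟩ hη1)
    (fun s hs => cuberoot_rpow_le_betaKernel13 ⟨hs.1, hs.2.trans_le (hη.2.trans (by norm_num))⟩)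
  rw [cuberoot_integral_rpow] at h
  exact h

/-- Upper bound for the incomplete beta integral near `0`:
`B(η; 1/3, 1/3) ≤ 3 · 2^{2/3} η^{1/3}` for `η ∈ (0, 1/2]`. [folklore] -/
theorem incBeta13_cuberoot_upper {η : ℝ} (hη : η ∈ Ioc (0 : ℝ) (1 / 2)) :
    incBeta13 η ≤ 3 * (2 : ℝ) ^ (2 / 3 : ℝ) * η ^ (1 / 3 : ℝ) := by
  have hη1 : η ∈ Icc (0 : ℝ) 1 := ⟨hη.1.le, hη.2.trans (by norm_num)⟩
  have h := integral_mono_on_of_le_Ioo (μ := volume) hη.1.le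
    (intervalIntegrable_betaKernel13_of_mem ⟨le_rfl, zero_le_one⟩ hη1)
    ((intervalIntegral.intervalIntegrable_rpow' (a := 0) (b := η) (r := -(2 / 3 : ℝ))
      (by norm_num)).const_mul ((2 : ℝ) ^ (2 / 3 : ℝ)))
    (fun s hs => cuberoot_betaKernel13_le ⟨hs.1, hs.2.le.trans hη.2⟩)
  rw [intervalIntegral.integral_const_mul, cuberoot_integral_rpow] at h
  calc incBeta13 η = ∫ s in (0 : ℝ)..η, betaKernel13 s := rfl
    _ ≤ (2 : ℝ) ^ (2 / 3 : ℝ) * (3 * η ^ (1 / 3 : ℝ)) := h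
    _ = 3 * (2 : ℝ) ^ (2 / 3 : ℝ) * η ^ (1 / 3 : ℝ) := by ring

end CardyAsymptotics

/-- **Cardy's function is comparable to `η^{1/3}` near `0`**: there are `c > 0` and `C` with
`c η^{1/3} ≤ F(η) ≤ C η^{1/3}` for `η ∈ (0, 1/2]`; explicitly `c = 3 / B(1/3,1/3)` and
`C = 3 · 2^{2/3} / B(1/3,1/3)`, from `F(η) = B(η; 1/3,1/3)/B(1/3,1/3)` and
`s^{-2/3} ≤ (s(1-s))^{-2/3} ≤ 2^{2/3} s^{-2/3}` on `(0, 1/2]`. [cite: Cardy1992, eq. (11)] -/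
theorem cardyFunction_cuberoot_sandwich : ∃ c C : ℝ, 0 < c ∧ ∀ η : ℝ, η ∈ Set.Ioc (0:ℝ) (1/2) → c * η ^ ((1:ℝ)/3) ≤ Literature.Probability.RandomPlanarGeometry.cardyFunction η ∧ Literature.Probability.RandomPlanarGeometry.cardyFunction η ≤ C * η ^ ((1:ℝ)/3) := by
  refine ⟨3 / incBeta13 1, 3 * (2 : ℝ) ^ (2 / 3 : ℝ) / incBeta13 1,
    div_pos three_pos incBeta13_one_pos, fun η hη => ?_⟩
  have hB : 0 < incBeta13 1 := incBeta13_one_pos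
  have hη1 : η ∈ Icc (0 : ℝ) 1 := ⟨hη.1.le, hη.2.trans (by norm_num)⟩
  rw [cardyFunction_eq_incBeta13_div_holds η hη1, div_mul_eq_mul_div, div_mul_eq_mul_div]
  exact ⟨div_le_div_of_nonneg_right (CardyAsymptotics.incBeta13_cuberoot_lower hη) hB.le,
    div_le_div_of_nonneg_right (CardyAsymptotics.incBeta13_cuberoot_upper hη) hB.le⟩

end Summit.CriticalPhenomena.CardyFormulaZ2.Cruxes.SubseqCardy.Birth
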